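import Mathlib
import HarnessLib
import HarnessLib.Audit
import Summits.BirchSwinnertonDyer.Statement
import HarnessLib.Audit.Check
import Literature.NumberTheory.EllipticCurves.Selmer
import Literature.NumberTheory.EllipticCurves.Sha
import Literature.NumberTheory.EllipticCurves.QuadraticTwist
import Literature.NumberTheory.EllipticCurves.GlobalMinimalModel
import Literature.NumberTheory.EllipticCurves.GaloisAction
import Literature.NumberTheory.EllipticCurves.Tamagawa
import Literature.NumberTheory.EllipticCurves.OrdinaryPrimes
import Literature.NumberTheory.DiophantineGeometry.Conductor
import Literature.NumberTheory.EllipticCurves.SelmerCorankHolds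
import Literature.NumberTheory.EllipticCurves.GlobalMinimalModelProofs
import Literature.NumberTheory.EllipticCurves.OrdinaryPrimesProofs
import Literature.NumberTheory.EllipticCurves.MinimalModelReduction
import Literature.NumberTheory.EllipticCurves.VariableChangePoints
import Literature.NumberTheory.DiophantineGeometry.LocalReductionProofs
import Literature.NumberTheory.DiophantineGeometry.MinimalModelUniquenessProofs
import Summits.BirchSwinnertonDyer.BirchSwinnertonDyer.Theorems.SelmerRankAssembly
import Summits.BirchSwinnertonDyer.BirchSwinnertonDyer.Theorems.SelmerRankShaCorank
import Literature.NumberTheory.EllipticCurves.Isogeny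
import Literature.NumberTheory.EllipticCurves.GrossPointsThetaElement
import HarnessLib.Audit.Status.Attr

/-!
Route: DefiniteTheta

# Route DefiniteTheta — Definite theta exact order — the p-power Gross-point tower of one sharp
definite datum caps the Selmer corank by r_an on the multiplicative sector

It suffices to show X = DEO ∧ CAP on the MULTIPLICATIVE SECTOR (elliptic E/ℚ, global minimal model
V, with at least one prime
of multiplicative reduction), inside the certified three-sector Selmer-rank frame shared with route
FrozenTwin (UBPotentiallyGood,
SelmerRankLB, SelmerRankShaPFinite, SelmerRankCM; SerrePrimeSupply is proved). DEO =
DefiniteExactOrder (attacked; card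
sum-versus-max-unbalanced-definite-theta-pfaffian K1): every such V admits an ADMISSIBLE DEFINITE
DATUM (p, K, N⁺, N⁻, S, T, φ) —
p ≥ 7 good ordinary, a_p ≢ 0, ±1 (mod p), ρ̄_{E,p} surjective, p ∤ q² − 1 for q ∣ N, p ∤ h_K; K
imaginary quadratic, d_K < −4,
(d_K, Np) = 1; N = N⁺N⁻ coprime, N⁻ squarefree with an odd number of prime factors, all inert in K,
every prime of N⁺ split;
S a Brandt/Eichler setup of level N⁺ in the definite quaternion algebra of discriminant N⁻; T the
tower of Gross points of
conductor p^n; φ a generator of the E-eigenline of the Brandt module — at which the ANTICYCLOTOMIC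
ORDER OF VANISHING of the
Bertolini–Darmon theta element, ord_J θ∞^{ac}(E, K, p) ∈ ℕ∞, is AT MOST r_an(E). CAP =
DerivedHeightCap (K2): at EVERY admissible
datum corank_{ℤ_p} Sel_{p^∞}(E/ℚ) ≤ ord_J θ∞^{ac}. With SelmerRankLB (r_an ≤ corank) the sector
closes: corank = r_an at that p.
Second card realised: sharp-auxiliary-field-eisenstein-theta (the free per-curve choice of the sharp
auxiliary pair (K, p) IS the
existential of DEO).
Lean: `DefiniteExactOrder ∧ DerivedHeightCap ∧ UBPotentiallyGood ∧ SelmerRankLB ∧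
SelmerRankShaPFinite ∧ SelmerRankCM`

## Assembly
Certified in glue.lean (`closes`, sorry-free; all seven hypotheses consumed; the body is
FrozenTwin's certified sector glue with
sector (a) replaced). Bookkeeping: Greenberg's identity corank Sel_{p^∞} = rank + corank Ш[p^∞]
(selmerCorank_eq_mordellWeilRank_add_holds),
corank Ш[p^∞] = 0 for finite Ш[p^∞] (Literature.BSD.shaCorank_eq_zero_of_finite), a global minimal
model (hasGlobalMinimalModel_rat_holds),
isomorphism invariance of rank / local Euler factors / analytic rank (T1–T3, proved inline),
selmerCorank_identity_imp_thesis_imp_bsd.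
Sector (a), V with a multiplicative prime: DEO gives the datum with ord_J θ ≤ r_an(V) in ℕ∞; CAP at
that datum gives (corank : ℕ∞) ≤
ord_J θ; cast to ℕ: corank ≤ r_an; the datum's p is ≥ 7 ≥ 5, good, ordinary, surjective, so
SelmerRankLB gives r_an ≤ corank.
Sector (b), integral j and no CM: SerrePrimeSupply's prime, UBPotentiallyGood ∧ SelmerRankLB. Sector
(c), CM: a good ordinary
p ≥ 5 (exists_good_ordinary_prime_holds, proved) and SelmerRankCM. Then SelmerRankShaPFinite at that
p turns corank = r_an into
rank = r_an on the minimal model, transported to W.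

Rationale: WHY THIS LINE. Mechanism: the definite theta element θ_n = Σ_{σ ∈ G_n} φ(x_n^σ) σ⁻¹ ∈ ℤ[G_n] of
Gross points of conductor p^n (BertoliniDarmon1996
§2, Gross1987 §11) interpolates L(E/K, χ, 1) over anticyclotomic characters; BD96 Conj 4.1 /
BertoliniDarmon1995 predict its
order of vanishing in the augmentation filtration equals max(r⁺, r⁻) (derived-height rank profile),
NOT the sum r⁺ + r⁻ seen by the
classical regulator — so choosing K with r_an(E^K) ≤ r_an(E) (BumpFriedbergHoffstein1990,
MurtyMurty1991) turns the '≤' half of that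
conjecture into ord_J θ ≤ r_an(E), an r_an-UPPER bound for the p-adic side that a finite computation
θ_n ∉ J_n^{r+1} certifies. The cap
is the transcribable direction: ChidaHsieh2013 Thm 1 (char_Λ Sel(K∞, A_f) ⊇ (θ∞²), after
BertoliniDarmon2005, PollackWeston2011,
Vatsal2003 μ = 0) + Greenberg control (GreenbergLNM1716) give θ_n² ∈ J^{s⁺+s⁻} ⊆ J^{2·0+s⁺…}, and
Howard2004DerivedHeights /
the finite-level square root give corank Sel_{p^∞}(E/ℚ) ≤ ord_J θ. Imported area: anticyclotomic
Iwasawa theory of definite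
quaternionic forms (Brandt modules, Jacquet–Langlands) and derived p-adic heights; the indefinite
sibling CastellaEtAl2023 Thm 1.5
(ϱ_alg ≥ 2(max − 1), equality ⇔ maximal non-degeneracy) and CastellaHsieh2022 Thm B (r = 2) show the
shape is live in print. No BSD
route reads the p-POWER-CONDUCTOR direction: FrozenTwin twists the same θ by class-group characters
at n = 0, ToricShedding counts
level-raising length, VerticalContact reads weight contact, PAdicOrderV2 / LeadingTerm / TangentCone
are cyclotomic, OnePairExactOrder
is the indefinite Heegner-module index on the r_an = 2 cell; the negatives index (one entry,
LeadingTermTamePinch: a ∀E ∃p supply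
with an over-tight side condition) is honoured by keeping every side condition of the datum jointly
satisfiable (N⁻ := one
multiplicative prime; K by CRT; p by Serre + density-zero of anomalous/supersingular primes).

RANKED CRUXES. #2 DefiniteExactOrder (crux) — every globally minimal elliptic V/ℚ with a prime of
multiplicative reduction admits an admissible definite datum (p, N⁺, N⁻, K, S, T, φ) (side
conditions as in § Thesis) at which the anticyclotomic order of vanishing of the definite theta
element at the p-adic unit root is ≤ r_an(V) in ℕ∞ (card
sum-versus-max-unbalanced-definite-theta-pfaffian K1; the '≤' half of BD96 Conj 4.1 with the twist
rank pushed below r_an(V) by the choice of K). [difficulty: open-problem] (why it might fail: The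
'≤' half of BD96 Conj 4.1 is derived-height NON-DEGENERACY (BD95 §3): open from (r⁺,r⁻) = (2,0) or
(1,1); the ac height vanishes on E(ℚ)×E(ℚ), so the leading term is a derived pairing h^(2) nobody
controls; accidental depth at EVERY admissible (K,p) of one curve kills it.) [BertoliniDarmon1996,
BertoliniDarmon1995, Howard2004DerivedHeights, CastellaEtAl2023, CastellaHsieh2022,
BumpFriedbergHoffstein1990, MurtyMurty1991]
#3 DerivedHeightCap (crux) — at EVERY admissible definite datum (same side conditions, universally
quantified) the ℤ_p-corank of Sel_{p^∞}(V/ℚ) is ≤ the anticyclotomic order of vanishing of the theta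
element (in ℕ∞) (card K2: IMC divisibility ChidaHsieh2013 Thm 1 + control give θ_n² ∈ J_n^{s⁺+s⁻}
for all n; a finite-level square root along the norm-compatible tower, or Howard's derived-height
theorem, gives θ_n ∈ J_n^{s⁺}). [difficulty: L] (why it might fail: Tree tower facts (existence,
norm-compatibility, Vatsal μ = 0) are typed for squarefree N but the datum allows q² ∣ N⁺ (CH15
covers it, the tree not yet); CH15 (CR⁺) ramification at q ∣ N⁻, q² ≡ 1 (p) is replaced by p ∤ q²−1;
the square root of J^{2ρ} in ℤ_p[G_n] may fail at finite level.) [ChidaHsieh2013,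
BertoliniDarmon2005, Howard2004DerivedHeights, GreenbergLNM1716, PollackWeston2011, Vatsal2003,
BertoliniLongoVenerucci2023]
#4 UBPotentiallyGood (crux) — the POTENTIALLY-GOOD SECTOR (no prime of multiplicative reduction):
for globally minimal W and every good ordinary p ≥ 5 with ρ̄ surjective, corank Sel_{p^∞}(W/ℚ) ≤
r_an(W) (shared item stmt-BirchSwinnertonDyer-15878 of FrozenTwin, verbatim). [difficulty:
open-problem] (why it might fail: It is SelmerRankUB on the integral-j class: open from corank 4; no
definite Gross-point setting exists for these curves (ε(E/K) = −1 for every coprime imaginary K when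
all conductor exponents are even), so no theta certificate has grip.) [Zhang2014, Kato2004,
SkinnerUrban2014, BurungaleEtAl2026]
#5 SelmerRankLB (crux) — lower-bound half of p^∞-Selmer BSD: for globally minimal W and good
ordinary p ≥ 5 with ρ̄ surjective, r_an(W) ≤ corank Sel_{p^∞}(W/ℚ) (shared item
stmt-BirchSwinnertonDyer-0131, verbatim). [difficulty: open-problem] (why it might fail: Theorem for
r_an ≤ 3 (BCS2025 1.1.2, BurungaleEtAl2026 Cor 1, p-parity); OPEN from r_an = 4: needs Selmer
classes out of high-order vanishing; the theta side only produces UPPER bounds.) [BurungaleEtAl2026,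
SkinnerUrban2014, Kato2004, arXiv:2412.20078]
#6 SelmerRankShaPFinite (crux) — Ш(W/ℚ)[p^∞] is finite for every elliptic W/ℚ and every prime p
(shared item stmt-BirchSwinnertonDyer-0132, verbatim; the summit-grade residual device of the
Selmer-rank frame). [difficulty: open-problem] (why it might fail: Known only for r_an ≤ 1
(Kolyvagin1990 Thm A, Kato2004 Thm 14.2); for r_an ≥ 2 nothing excludes an infinitely divisible
element of Ш at every p; the theta certificate kills Ш[p] only at sharp (K,p), not at every p.)
[Kolyvagin1990, Kato2004, SilvermanAEC2009, GreenbergLNM1716]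
#8 SelmerRankCM (crux) — CM SECTOR: for globally minimal W with complex multiplication and every
good ordinary p ≥ 5, corank Sel_{p^∞}(W/ℚ) = r_an(W) (shared item stmt-BirchSwinnertonDyer-18086,
verbatim). [difficulty: open-problem] (why it might fail: Open once min(corank_p, r_an) ≥ 2: Rubin's
two-variable IMC bounds corank_p by the order of a Katz p-adic L whose comparison with r_an needs a
non-degenerate CM p-adic height (Bertrand1982 = rank 1); r_an ≤ corank_p beyond p-parity has no
engine.) [Rubin1991MainConj, CoatesWiles1977, arXiv:2506.03465, doi:10.1007/s00222-019-00929-7]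
#9 SerrePrimeSupply (support) — every non-CM globally minimal W/ℚ has a prime p ≥ 5 of good ordinary
reduction with ρ̄_{W,p} surjective (shared item stmt-BirchSwinnertonDyer-17959, PROVED in tree by
Theorems.frozenTwin_serrePrimeSupply_proof: Serre open image + infinitely many ordinary primes).
[difficulty: provable-now] [Serre1972,
Literature.NumberTheory.EllipticCurves.serre_open_image_holds]

TWO-LAYER PLAN. Foreseen glued splits (BC3 skeletons elaborate, rc 0, sorries = stubs):
DefiniteExactOrder ⇐ SupplyMinimalTwist (∃ admissible datum
with r_an(V^{d_K}) ≤ r_an(V): BFH90/MM91 + CRT + Serre) → Conj41Upper (∀ admissible datum, ord_J θ ≤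
max(r_an(V), r_an(V^{d_K})):
the '≤' half of BD96 Conj 4.1) → DefiniteExactOrder (bc/DefiniteExactOrder_birth.lean,
`DefiniteExactOrder_of`); DerivedHeightCap ⇐
SqCap (∀ datum ∀ n, θ_n² ∈ J_n^{2·corank}: CH15 divisibility + control + corank Sel(E/K) = s⁺ + s⁻ ≥
2·0 + …) → NormCompatible
(BD96 §2: the tower's theta elements are norm-compatible at the unit root) → TowerSqrt (pure algebra
in ℤ_p[G_n^{ac}], G cyclic
p-group, along a norm-compatible family: u_n² ∈ J^{2ρ} ∀ n ⇒ u_n ∈ J^ρ ∀ n) → DerivedHeightCap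
(bc/DerivedHeightCap_birth.lean,
`DerivedHeightCap_of` via GrossPointTower.le_acOrderOfVanishing). BC5 first rung (plan-only, first
prover target): Rung234446a1 —
for V = [1,−1,0,−79,289] (Cremona 234446a1, rank 4) some admissible datum has θ_n ∉ J_n^5 at some
level n (kit certificate, 2001
data: 8 admissible pairs, p ∈ {11, 13, 17, 19}).

KILL CRITERIA. refuted:DerivedHeightCap — an admissible datum (V, p, K, …) and a level n with θ_n ∉
J_n^{s}, s = a KNOWN lower bound for corank
Sel_{p^∞}(V/ℚ) (e.g. s = rank V(ℚ)): the kit certificate run on 389a1 / 5077a1 / 234446a1 doubles as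
this test; if it dies only at
non-squarefree N⁺ or at a CH15-(CR⁺)-violating datum the statement is misstated (restate with the
tree's squarefree vocabulary),
else the line is dead. refuted:DefiniteExactOrder — a theorem placing θ∞ ∈ J^{r_an+1} for EVERY
admissible datum of one
multiplicative-sector curve (e.g. a structural degeneracy of h^(2) on E(ℚ)-classes) closes the route
outright; a kit run finding
θ_n ∈ J_n^{r+1} for all n ≤ 3 at ALL admissible pairs of 389a1 forces a pivot to the indefinite
sibling (CastellaEtAl2023 shape,
card sharp-auxiliary-field-eisenstein-theta). Mooted by: FrozenTwin's GrossMomentSharpness ∧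
FrozenTwinBound or ToricShedding closing
the same sector; SelmerRankUB proved outright.

NOT DECOMPOSED YET. The Λ-adic layer (Λ = ℤ_p⟦G_∞^{ac}⟧ ≅ ℤ_p⟦T⟧, characteristic ideals, CH15 as a
named Literature fact over GrossPointTower, Greenberg
control for Sel over K_∞^{ac}) and the derived-height interface (BD95/Howard04 filtration S^(k),
pairings h^(k)) are deliberately NOT
items: they are definition requests and layer-2 children of DerivedHeightCap once SqCap is attacked.
The non-squarefree-N⁺ extension
of the tree's tower facts, the sign ε of Atkin–Lehner on φ, and the choice n ↦ level in the
certificate are prover-side lemmas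
(`--supports`). No split of the shared sector items here (they are FrozenTwin's / Squeeze's to
decompose).

CHEAPEST FALSIFIER. Re-run the 2001 finite-layer certificate as ONE kit job (Brandt module of level
N⁺ in the definite algebra of discriminant N⁻ = the
multiplicative prime, Gross points of conductor p^n for n ≤ 3, θ_n mod (p^k, J^{m})): 389a1 (r = 2)
at p ∈ {7, 11}, 5077a1 (r = 3)
and 234446a1 (r = 4) at p ∈ {11, 13}, smallest admissible K each. CHECK 1 (kills CAP): θ_n ∈ J_n^{r}
must hold at every level
(r = rank ≤ corank). CHECK 2 (DEO certificate / BC5 rung): θ_n ∉ J_n^{r+1} at some n ≤ 3. Not run in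
this typing seat (no kit in
the type-sketch lane); it is the route's first prover target (stub_rung234446a1).

NUMBERS. CH15 Thm 1 hypotheses for weight 2 (arXiv:1304.3311 p.3–4): p > 3 and #(𝔽_p^×) > 5 ⇒ p ≥ 7;
(PO) a_p² ≢ 1 (mod p); N⁻ squarefree,
odd number of inert primes; conclusion char_Λ Sel(K∞, A_f) ⊇ (L_p(K∞, f)), L_p = θ∞². Indefinite
sibling (arXiv:2308.10474 p.3–4):
Conj 1.1(ii) ϱ_an = 2(max{r⁺, r⁻} − 1), Thm 1.5 ϱ_alg ≥ 2(max − 1) with equality iff maximal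
non-degeneracy. 2001 certificate
inventory (SKETCH.md): 389a1 15 admissible (K,p) pairs, 5077a1 12, 234446a1 8, p ∈ {7,…,19}; side
condition p ∤ q²−1 removes
p = 13 for 389a1 (13 ∣ 390) and p = 7 for 234446a1 (7 ∣ 117222).

DEFINITION REQUESTS. D1 (for DerivedHeightCap's Howard-style proof, not for any statement): derived
p-adic height data — the BD95/Howard04 filtration
S^(1) ⊇ S^(2) ⊇ … of Sel_{p^∞}(E/K) ⊗ ℚ_p/ℤ_p-dual with pairings h^(k) and their τ-parity — as an
interface under
Literature/NumberTheory/EllipticCurves + an existence fact. D2: the identification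
completedGroupRing ℤ_p (AcLayerGroup K p ·) ≅
Λ = ℤ_p⟦T⟧ (Iwasawa–Serre) to state CH15 Thm 1 as a named fact `chidaHsieh_charIdeal_dvd_thetaSq`
over GrossPointTower, and
Greenberg's control theorem for Sel over K_∞^{ac}. Cite facts wanted: ChidaHsieh2013 Thm 1 (weight 2
case); BertoliniDarmon1996 §2.7
norm-compatibility for general (non-squarefree) N⁺; Friedberg–Hoffstein 1995 Thm B with prescribed
splitting (twist supply).

Novelty: Searches (2026-08-17): `lit search --hybrid "anticyclotomic theta element order of vanishing derived
heights"` (CH15, BD05, Howard04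
held); `lit galaxy search "Mumford-Tate curves|anticyclotomic Iwasawa|anticyclotomic setting" --star
pdf` (3: ANT 10:2 = Kriz 2016
[galaxy:pdf:-836071279501726160], Rotger–Seveso, Li–Zhu ANT 11:10); `lit galaxy search
"non-degeneracy of the p-adic height|derived
heights" --star pdf` (0 relevant); galaxy panama: [galaxy:panama:322062417657888] LNM 1716,
[galaxy:panama:350795748868160] p-adic
aspects of modular forms, [galaxy:panama:391752557002789] Kriz AMS-212; `lit read arXiv:1304.3311`
p.3–4 (CH15 Thm 1 + hypotheses),
`lit read arXiv:2308.10474` p.3–4 (CHKLL Conj 1.1, Thm 1.5), `lit read arXiv:2306.17784` p.3 (BLV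
Hyp 1.1 excludes multiplicative
q ∣ N⁺ — why CAP leans on CH15 not BLV); `lean search` GrossPointTower / acOrderOfVanishing (tree
module only; no theorem of shape
C → S or S ↔ C); `ledger negatives --problem BirchSwinnertonDyer` (1 entry, unrelated); all 16
Theses of the sub read for levers.
Nearest prior art found: BertoliniDarmon1996 Conj 4.1 + BertoliniDarmon1995 (conjectured exact order
= derived rank profile, no
proof of '≤' beyond order 0); Howard2004DerivedHeights (θ ∈ J^{…}: the '≥' direction);
ChidaHsieh2013 Thm 1 (divisibility);
CastellaEtAl2023 Thm 1.5 / Conj 1.1 (indefinite BDP analogue, '≥' proved, '=' ⇔ maximal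
non-degeneracy); CastellaHsieh2022 Thm B
(r = 2 bridge). Nearest routes: FrozenTwin (same θ, n = 0 class-group  [refs: 1304.3311, 2308.10474, 2306.17784, BertoliniDarmon1996, BertoliniDarmon1995, ChidaHsieh2013, CastellaEtAl2023, CastellaHsieh2022]

Barriers (technique_class: anticyclotomic-iwasawa, definite-theta, derived-heights): - technique_class: anticyclotomic-iwasawa, definite-theta, derived-heights
- Literature.Barriers.BirchSwinnertonDyer.AnticyclotomicHeightDegeneracy: bites DefiniteExactOrder
head-on at a FIXED (K,p) (anti-equivariant pairings vanish on E(ℚ) × E(ℚ); the leading term is a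
derived pairing); evaded only by the ∃ over (p, K, N±, S) per curve and by certifying at finite
level (θ_n ∉ J^{r+1} is a computation in ℤ_p[G_n], not a height); DerivedHeightCap needs no
non-degeneracy at all (divisibility + control). The bet: every multiplicative-sector curve has one
maximally non-degenerate admissible datum.
- Literature.Barriers.BirchSwinnertonDyer.AnticyclotomicHeightDegeneracyNarrow: outside — no
full-rank Gram determinant of a p-adic pairing is ever asserted; the invariant is an order of
vanishing in the augmentation filtration, whose expected value max(r⁺, r⁻) already accounts for the
forced degeneracy.
- Literature.Barriers.BirchSwinnertonDyer.ExceptionalZeroBarrier: outside — the datum has p ∤ N d_K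
good ordinary with a_p ≢ 0, ±1 (mod p), so e_p(f, 1) ≢ 0 (ChidaHsieh2013 p.3, (PO)) and θ has no
trivial zero at the trivial character.
- Literature.Barriers.BirchSwinnertonDyer.FunctionalEquationSeesOnlyParity: outside — the definite
sign ε(E/K) = +1 is arranged by (N⁺ split, N⁻ inert, odd); parity is never used to produce or bound
rank; the bound is an inequality in ℕ∞. Same for the Λ-adic involution class (file
PAdicFunctionalEquationParity, decl PAdicFunctionalEquationSeesOnlyParity):

sub-problem: BirchSwinnertonDyer · status: draft · opened planner-type-d241731569-0 2026-08-17T16:29:11Z · rev 0 · ledger route-BirchSwinnertonDyer-DefiniteTheta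
GENERATED by the gate from the ledger (D-0016/17). Provers cite these decls: `theorem foo : Summit.BirchSwinnertonDyer.BirchSwinnertonDyer.Theses.DefiniteTheta.<Decl> := …` in Summits/BirchSwinnertonDyer/BirchSwinnertonDyer/Theorems/<Name>.lean.
-/

namespace Summit.BirchSwinnertonDyer.BirchSwinnertonDyer.Theses.DefiniteTheta

open scoped BigOperators Topology Manifold Classical MeasureTheory ProbabilityTheory Matrix InnerProductSpace ComplexConjugate ContinuousMap
open Filter Set Function TopologicalSpace MeasureTheory

attribute [summit_statement] _root_.BirchSwinnertonDyer

open Literature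

/-- item stmt-BirchSwinnertonDyer-18437 · crux · rank 2 · open · by planner
why it might fail: The '≤' half of BD96 Conj 4.1 is derived-height NON-DEGENERACY (BD95 §3): open from (r⁺,r⁻) = (2,0) or (1,1); the ac height vanishes on E(ℚ)×E(ℚ), so the leading term is a derived pairing h^(2) nobody controls; accidental depth at EVERY admissible (K,p) of one curve kills it.
sources: BertoliniDarmon1996, BertoliniDarmon1995, Howard2004DerivedHeights, CastellaEtAl2023, CastellaHsieh2022, BumpFriedbergHoffstein1990
[crux] every globally minimal elliptic V/ℚ with a prime of multiplicative reduction admits an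
admissible definite datum (p, N⁺, N⁻, K, S, T, φ) (side conditions as in § Thesis) at which the
anticyclotomic order of vanishing of the definite theta element at the p-adic unit root is ≤ r_an(V)
in ℕ∞ (card sum-versus-max-unbalanced-definite-theta-pfaffian K1; the '≤' half of BD96 Conj 4.1 with
the twist rank pushed below r_an(V) by the choice of K). [difficulty: open-problem] -/
@[route_item "route-BirchSwinnertonDyer-DefiniteTheta", crux]
def DefiniteExactOrder : Prop :=
  ∀ (V : WeierstrassCurve ℚ) [V.IsElliptic] [V.IsGloballyMinimal], (∃ (q : ℕ) (_ : Fact q.Prime), V.HasMultiplicativeReductionAtPrime q) → ∃ (p : ℕ) (_ : Fact p.Prime) (Nplus Nminus : ℕ) (K : Type) (_ : Field K) (_ : NumberField K) (S : Literature.NumberTheory.Automorphic.Brandt.XiSetup Nplus Nminus) (_ : Fintype (Literature.NumberTheory.Automorphic.Brandt.ClassSet S.O)) (T : Literature.NumberTheory.EllipticCurves.GrossPointTower K S p) (φ : Literature.NumberTheory.Automorphic.Brandt.ClassSet S.O → ℤ), ((7 ≤ p ∧ V.HasGoodReductionAtPrime p ∧ ¬ (p : ℤ) ∣ V.frobeniusTrace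 p ∧ ¬ (p : ℤ) ∣ (V.frobeniusTrace p) ^ 2 - 1 ∧ V.HasSurjectiveModNGaloisRep p ∧ (∀ q : ℕ, q.Prime → q ∣ V.conductorNorm ℤ → ¬ (p : ℤ) ∣ (q : ℤ) ^ 2 - 1) ∧ ¬ p ∣ NumberField.classNumber K) ∧ (Module.finrank ℚ K = 2 ∧ NumberField.IsTotallyComplex K ∧ NumberField.discr K < -4 ∧ Int.gcd (NumberField.discr K) (V.conductorNorm ℤ * p) = 1) ∧ (V.conductorNorm ℤ = Nplus * Nminus ∧ Nat.Coprime Nplus Nminus ∧ Odd Nminus.primeFactors.card ∧ (∀ q : ℕ, q.Prime → q ∣ Nplus → ((Ideal.span {(q : ℤ)}).primesOver (NumberField.RingOfIntegers K)).ncard = 2) ∧ (∀ q : ℕ, q.Prime → q ∣ Nminus → ((Ideal.span {(q : ℤ)}).primesOver (NumberField.RingOfIntegers K)).ncard = 1)) ∧ (φ ≠ 0 ∧ Literature.NumberTheory.Automorphic.Brandt.eigenLattice (Nplus * Nminus) (Literature.NumberTheory.Automorphic.Brandt.matrix S.O) (fun n => V.LFunction n) = Submodule.span ℤ {φ})) ∧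 T.acOrderOfVanishing p φ (Literature.NumberTheory.EllipticCurves.padicUnitRoot p (V.LFunction p)) ≤ (V.analyticRank : ℕ∞)

/-- item stmt-BirchSwinnertonDyer-18438 · crux · rank 3 · open · by planner
why it might fail: Tree tower facts (existence, norm-compatibility, Vatsal μ = 0) are typed for squarefree N but the datum allows q² ∣ N⁺ (CH15 covers it, the tree not yet); CH15 (CR⁺) ramification at q ∣ N⁻, q² ≡ 1 (p) is replaced by p ∤ q²−1; the square root of J^{2ρ} in ℤ_p[G_n] may fail at finite level.
sources: ChidaHsieh2013, BertoliniDarmon2005, Howard2004DerivedHeights, GreenbergLNM1716, PollackWeston2011, Vatsal2003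
[crux] at EVERY admissible definite datum (same side conditions, universally quantified) the
ℤ_p-corank of Sel_{p^∞}(V/ℚ) is ≤ the anticyclotomic order of vanishing of the theta element (in ℕ∞)
(card K2: IMC divisibility ChidaHsieh2013 Thm 1 + control give θ_n² ∈ J_n^{s⁺+s⁻} for all n; a
finite-level square root along the norm-compatible tower, or Howard's derived-height theorem, gives
θ_n ∈ J_n^{s⁺}). [difficulty: L] -/
@[route_item "route-BirchSwinnertonDyer-DefiniteTheta", crux]
def DerivedHeightCap : Prop :=
  ∀ (V : WeierstrassCurve ℚ) [V.IsElliptic] [V.IsGloballyMinimal] (p : ℕ) [Fact p.Prime] (Nplus Nminus : ℕ) (K : Type) [Field K] [NumberField K] (S : Literature.NumberTheory.Automorphic.Brandt.XiSetup Nplus Nminus) [Fintype (Literature.NumberTheory.Automorphic.Brandt.ClassSet S.O)] (T : Literature.NumberTheory.EllipticCurves.GrossPointTower K S p) (φ : Literature.NumberTheory.Automorphic.Brandt.ClassSet S.O → ℤ), ((7 ≤ p ∧ V.HasGoodReductionAtPrime p ∧ ¬ (p : ℤ) ∣ V.frobeniusTrace p ∧ ¬ (p : ℤ) ∣ (V.frobeniusTrace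 p) ^ 2 - 1 ∧ V.HasSurjectiveModNGaloisRep p ∧ (∀ q : ℕ, q.Prime → q ∣ V.conductorNorm ℤ → ¬ (p : ℤ) ∣ (q : ℤ) ^ 2 - 1) ∧ ¬ p ∣ NumberField.classNumber K) ∧ (Module.finrank ℚ K = 2 ∧ NumberField.IsTotallyComplex K ∧ NumberField.discr K < -4 ∧ Int.gcd (NumberField.discr K) (V.conductorNorm ℤ * p) = 1) ∧ (V.conductorNorm ℤ = Nplus * Nminus ∧ Nat.Coprime Nplus Nminus ∧ Odd Nminus.primeFactors.card ∧ (∀ q : ℕ, q.Prime → q ∣ Nplus → ((Ideal.span {(q : ℤ)}).primesOver (NumberField.RingOfIntegers K)).ncard = 2) ∧ (∀ q : ℕ, q.Prime → q ∣ Nminus → ((Ideal.span {(q : ℤ)}).primesOver (NumberField.RingOfIntegers K)).ncard = 1)) ∧ (φ ≠ 0 ∧ Literature.NumberTheory.Automorphic.Brandt.eigenLattice (Nplus * Nminus) (Literature.NumberTheory.Automorphic.Brandt.matrix S.O) (fun n => V.LFunction n) = Submodule.span ℤ {φ})) → ((V.selmerCorank p : ℕ) : ℕ∞) ≤ T.acOrderOfVanishing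 p φ (Literature.NumberTheory.EllipticCurves.padicUnitRoot p (V.LFunction p))

/-- item stmt-BirchSwinnertonDyer-15878 · crux · rank 4 · open · by planner
why it might fail: It is SelmerRankUB on the integral-j class: open from corank 4; no definite Gross-point setting exists for these curves (ε(E/K) = −1 for every coprime imaginary K when all conductor exponents are even), so no theta certificate has grip.
sources: Zhang2014, Kato2004, SkinnerUrban2014, BurungaleEtAl2026
[crux] the POTENTIALLY-GOOD SECTOR (no prime of multiplicative reduction, i.e. integral j: the
definite setting of ToricShedding needs an odd number of inert multiplicative primes): for such E
(globally minimal W) and every good ordinary p ≥ 5 with ρ̄ surjective, corank Sel_{p^∞}(E/ℚ) ≤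
r_an(E). Intended mechanism: the same shedding in the Heegner setting N⁻ = 1 (Kolyvagin's derived
classes on X₀(N); Kolyvagin–Zhang structure theorem Zhang2014 Thm 4.7 / WZhang2014: κ ≠ 0 ⇒ max
r_p^± = ord κ + 1) once Heegner points of conductor n are a tree notion (definition request D1).
[difficulty: open-problem] -/
@[route_item "route-BirchSwinnertonDyer-DefiniteTheta", crux]
def UBPotentiallyGood : Prop :=
  ∀ (W : WeierstrassCurve ℚ) [W.IsElliptic] [W.IsGloballyMinimal], (¬ ∃ (q : ℕ) (_ : Fact q.Prime), W.HasMultiplicativeReductionAtPrime q) → ∀ (p : ℕ) [Fact p.Prime], 5 ≤ p → W.HasGoodReductionAtPrime p → ¬ (p : ℤ) ∣ W.frobeniusTrace p → W.HasSurjectiveModNGaloisRep p → W.selmerCorank p ≤ W.analyticRank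

/-- item stmt-BirchSwinnertonDyer-0131 · crux · rank 5 · open · by planner
why it might fail: Theorem for r_an ≤ 3 (BCS2025 1.1.2, BurungaleEtAl2026 Cor 1, p-parity); OPEN from r_an = 4: needs Selmer classes out of high-order vanishing; the theta side only produces UPPER bounds.
sources: BurungaleEtAl2026, SkinnerUrban2014, Kato2004, arXiv:2412.20078
Lower bound half of p^∞-Selmer BSD under Skinner2020-type hypotheses. Known when r_an ≤ 3
(SkinnerUrban2014 Thm 2 corank-0 converse, Skinner2020 Thm A corank-1 converse, p-parity
DokchitserDokchitser2010). imports: Summits.BirchSwinnertonDyer.Statement,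
Literature.NumberTheory.EllipticCurves.{Selmer,Sha,Heights,GaloisAction,Tamagawa,BSDInvariants}
(routes/Sketch.lean, lean check rc 0 on 2026-08-13). -/
@[route_item "route-BirchSwinnertonDyer-DefiniteTheta", crux]
def SelmerRankLB : Prop :=
  ∀ (W : WeierstrassCurve ℚ) [W.IsElliptic] [W.IsGloballyMinimal] (p : ℕ) [Fact p.Prime], 5 ≤ p → W.HasGoodReductionAtPrime p → ¬ (p : ℤ) ∣ W.frobeniusTrace p → W.HasSurjectiveModNGaloisRep p → W.analyticRank ≤ W.selmerCorank p

/-- item stmt-BirchSwinnertonDyer-0132 · crux · rank 6 · open · by planner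
why it might fail: Known only for r_an ≤ 1 (Kolyvagin1990 Thm A, Kato2004 Thm 14.2); for r_an ≥ 2 nothing excludes an infinitely divisible element of Ш at every p; the theta certificate kills Ш[p] only at sharp (K,p), not at every p.
sources: Kolyvagin1990, Kato2004, SilvermanAEC2009, GreenbergLNM1716
p-primary Tate–Shafarevich finiteness (weaker than Literature.BSD.ShaFiniteConjecture, prime by
prime). Known when r_an ≤ 1 (Kolyvagin1990 Thm A; Kato2004 Thm 14.2 =
Literature.NumberTheory.EllipticCurves.kato_finite_of_L_one_ne_zero for r_an = 0). Tate1974 §1.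
imports: Summits.BirchSwinnertonDyer.Statement,
Literature.NumberTheory.EllipticCurves.{Selmer,Sha,Heights,GaloisAction,Tamagawa,BSDInvariants}
(routes/Sketch.lean, lean check rc 0 on 2026-08-13). -/
@[route_item "route-BirchSwinnertonDyer-DefiniteTheta", crux]
def SelmerRankShaPFinite : Prop :=
  ∀ (W : WeierstrassCurve ℚ) [W.IsElliptic] (p : ℕ) [Fact p.Prime], Finite ↥(AddCommGroup.primaryComponent W.sha p)

/-- item stmt-BirchSwinnertonDyer-18086 · crux · rank 8 · open · by planner
why it might fail: Open once min(corank_p, r_an) ≥ 2: Rubin's two-variable IMC bounds corank_p by the order of a Katz p-adic L whose comparison with r_an needs a non-degenerate CM p-adic height (Bertrand1982 = rank 1); r_an ≤ corank_p beyond p-parity has no engine.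
sources: Rubin1991MainConj, CoatesWiles1977, arXiv:2506.03465, doi:10.1007/s00222-019-00929-7
[crux] CM SECTOR of SelmerRankSmallImage (stmt-BirchSwinnertonDyer-14418) — Selmer-rank BSD for
elliptic curves E/ℚ WITH COMPLEX MULTIPLICATION (globally minimal W, W.HasCM) at every prime p ≥ 5
of good ordinary reduction (the primes split in the CM field): corank_{ℤ_p} Sel_{p^∞}(E/ℚ) =
ord_{s=1} L(E,s). Filed by the route-choice planner (unit
rchoice-Summits-BirchSwinnertonDyer-Bi-aee6ff5b, 2026-08-17; payload.route_choice on
Theorems/TangentConeSelmerRankSmallImageReduction.lean, p146239, whose hypothesis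
burungaleTian_analyticRank_eq_zero_of_selmerCorank_eq_zero_of_hasCM is an XL-apex non-crux fact) as
the RE-ROUTE: with Serre's open image theorem PROVED in tree
(Literature.NumberTheory.EllipticCurves.serre_open_image_holds) every non-CM curve has a big-image
good ordinary prime q ≥ 5 (Theorems.exists_goodOrdinary_surjective_of_not_hasCM, landed), where this
route's own big-image items give corank_q = r_an, and the route's Ш item(s) transfer the corank to
any other prime through Greenberg's proved identity corank Sel_{p^∞} = rank + corank Ш[p^∞]; hence
the small-image crux costs, beyond items the route already carries, EXACTLY this statement and
NOTHING from the literature — the -/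
@[route_item "route-BirchSwinnertonDyer-DefiniteTheta", crux]
def SelmerRankCM : Prop :=
  ∀ (W : WeierstrassCurve ℚ) [W.IsElliptic] [W.IsGloballyMinimal] (p : ℕ) [Fact p.Prime], 5 ≤ p → W.HasGoodReductionAtPrime p → ¬ (p : ℤ) ∣ W.frobeniusTrace p → W.HasCM → W.selmerCorank p = W.analyticRank

/-- item stmt-BirchSwinnertonDyer-18439 · support · rank 9 · open · by planner
sources: Serre1972, Literature.NumberTheory.EllipticCurves.serre_open_image_holds
[support] every non-CM globally minimal W/ℚ has a prime p ≥ 5 of good ordinary reduction with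
ρ̄_{W,p} surjective (shared item stmt-BirchSwinnertonDyer-17959, PROVED in tree by
Theorems.frozenTwin_serrePrimeSupply_proof: Serre open image + infinitely many ordinary primes).
[difficulty: provable-now] -/
@[route_item "route-BirchSwinnertonDyer-DefiniteTheta", crux]
def SerrePrimeSupply : Prop :=
  ∀ (W : WeierstrassCurve ℚ) [W.IsElliptic] [W.IsGloballyMinimal], ¬ W.HasCM → ∃ (p : ℕ) (_ : Fact p.Prime), 5 ≤ p ∧ W.HasGoodReductionAtPrime p ∧ ¬ (p : ℤ) ∣ W.frobeniusTrace p ∧ W.HasSurjectiveModNGaloisRep p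

/-- item stmt-BirchSwinnertonDyer-18440 · assembly · rank 1 · closed · proved by Summit.BirchSwinnertonDyer.BirchSwinnertonDyer.Theorems.definiteTheta_assembly_proof (prover) · by planner
sources: GreenbergLNM1716, BertoliniDarmon1996, ChidaHsieh2013
[assembly] DefiniteExactOrder → DerivedHeightCap → UBPotentiallyGood → SelmerRankLB →
SelmerRankShaPFinite → SelmerRankCM → SerrePrimeSupply → BSD-rank. -/
@[route_item "route-BirchSwinnertonDyer-DefiniteTheta"]
def Assembly : Prop :=
  DefiniteExactOrder → DerivedHeightCap → UBPotentiallyGood → SelmerRankLB → SelmerRankShaPFinite → SelmerRankCM → SerrePrimeSupply → _root_.BirchSwinnertonDyer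

-- `Assembly` holds: proved by `Summit.BirchSwinnertonDyer.BirchSwinnertonDyer.Theorems.definiteTheta_assembly_proof` (its module imports this route file, so no `_holds` link can be stated here).

/-! D-0027 §2.1 — DECIDING THEOREM (planner-authored via `route open/edit --closes-file`; by planner-type-d241731569-0 2026-08-17T16:29:11Z):
its hypotheses are this route's items and its conclusion the sub-problem Statement (glue_lint), and it elaborates with this file. -/

@[closes "route-BirchSwinnertonDyer-DefiniteTheta"] theorem closes (hDEO : DefiniteExactOrder) (hCAP : DerivedHeightCap) (hPG : UBPotentiallyGood)
    (hLB : SelmerRankLB) (hSha : SelmerRankShaPFinite) (hCM : SelmerRankCM) (hSerre : SerrePrimeSupply) :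
    _root_.BirchSwinnertonDyer := by
  -- Bookkeeping (verbatim from the certified glue of route FrozenTwin): Greenberg's corank identity
  -- (proved), shaCorank = 0 for finite Ш[p^∞] (proved), a global minimal model (proved), a good ordinary
  -- p ≥ 5 (proved), isomorphism invariance of rank / Euler factors / analytic rank (T1–T3), and
  -- selmerCorank_identity_imp_thesis_imp_bsd. Selmer-rank BSD at ONE prime in three sectors:
  -- (a) a multiplicative prime — DefiniteExactOrder supplies an admissible definite datum
  -- (p, K, N⁺, N⁻, S, T, φ) with ord_J θ^{ac} ≤ r_an(E) in ℕ∞, DerivedHeightCap gives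
  -- (corank Sel_{p^∞}(E/ℚ) : ℕ∞) ≤ ord_J θ^{ac}, hence corank ≤ r_an in ℕ; SelmerRankLB (p ≥ 7 ≥ 5, good,
  -- ordinary, surjective are among the datum's side conditions) gives equality;
  -- (b) integral j, no CM — the Serre big-image good ordinary prime of SerrePrimeSupply, where
  -- UBPotentiallyGood ∧ SelmerRankLB give corank = r_an; (c) CM — any good ordinary p ≥ 5 (proved supply)
  -- and SelmerRankCM.
  have hId : ∀ (W : WeierstrassCurve ℚ), W.selmerCorank_eq_mordellWeilRank_add :=
    fun W => W.selmerCorank_eq_mordellWeilRank_add_holds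
  have hZ : ∀ (W : WeierstrassCurve ℚ) [W.IsElliptic] (p : ℕ) [Fact p.Prime],
      Finite ↥(AddCommGroup.primaryComponent W.sha p) → W.shaCorank p = 0 :=
    Literature.BSD.shaCorank_eq_zero_of_finite
  -- (T1) the Mordell–Weil rank is an isomorphism invariant (AEC III.3.1(b); `VariableChangePoints`)
  have hMW : ∀ (W : WeierstrassCurve ℚ) (C : WeierstrassCurve.VariableChange ℚ),
      (C • W).mordellWeilRank = W.mordellWeilRank := fun W C =>
    @WeierstrassCurve.VariableChange.finrank_point_variableChange ℚ _ W C (Classical.decEq ℚ)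
  -- (T2) the local Euler factor is an isomorphism invariant (AEC VII.1.3(b), VII.2, VII.5.1, C §16)
  have hloc : ∀ (R : Type) [CommRing R] [IsDomain R] [IsDiscreteValuationRing R]
      (K : Type) [Field K] [Algebra R K] [IsFractionRing R K]
      (W : WeierstrassCurve K) [W.IsElliptic] (C : WeierstrassCurve.VariableChange K),
      (C • W).localEulerFactor R = W.localEulerFactor R := by
    intro R _ _ _ K _ _ _ W _ C
    obtain ⟨D, hD⟩ : ∃ D : WeierstrassCurve.VariableChange K,
        (C • W).minimal R = D • W.minimal R :=
      ⟨((C • W).exists_isMinimal R).choose * C * ((W.exists_isMinimal R).choose)⁻¹, by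
        rw [WeierstrassCurve.minimal, WeierstrassCurve.minimal, mul_smul, mul_smul, inv_smul_smul]⟩
    haveI hE : (W.minimal R).IsElliptic := by rw [WeierstrassCurve.minimal]; infer_instance
    have hΔ : (W.minimal R).Δ ≠ 0 := (W.minimal R).isUnit_Δ.ne_zero
    have hgood : ((C • W).minimal R).HasGoodReduction R ↔ (W.minimal R).HasGoodReduction R := by
      rw [WeierstrassCurve.hasGoodReduction_iff, WeierstrassCurve.hasGoodReduction_iff,
        WeierstrassCurve.valuation_Δ_eq_of_isMinimal_of_eq_smul R hD]
      exact and_congr_left' ⟨fun _ => inferInstance, fun _ => inferInstance⟩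
    have hcard : Nat.card (((C • W).minimal R).reduction R).toAffine.Point =
        Nat.card ((W.minimal R).reduction R).toAffine.Point := by
      obtain ⟨E, hE⟩ := WeierstrassCurve.exists_reduction_eq_smul R hD hΔ
      rw [hE]
      exact WeierstrassCurve.natCard_point_smul _ _
    have hpoly : (C • W).localPolynomial R = W.localPolynomial R := by
      classical
      unfold WeierstrassCurve.localPolynomial
      simp only [hgood, hcard,
        WeierstrassCurve.hasSplitMultiplicativeReduction_iff_of_isMinimal_of_eq_smul R hD hΔ,
        WeierstrassCurve.hasMultiplicativeReduction_iff_of_isMinimal_of_eq_smul R hD hΔ]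
    simp only [WeierstrassCurve.localEulerFactor, WeierstrassCurve.localPowerSeries, hpoly]
  -- (T3) hence the analytic rank is an isomorphism invariant (AEC App. C §16)
  have hAn : ∀ (W : WeierstrassCurve ℚ) [W.IsElliptic] (C : WeierstrassCurve.VariableChange ℚ),
      (C • W).analyticRank = W.analyticRank := by
    intro W _ C
    have hL : (C • W).LFunction = W.LFunction := by
      unfold WeierstrassCurve.LFunction
      congr 1
      funext v
      simp only [WeierstrassCurve.baseChange, ← WeierstrassCurve.map_variableChange]
      exact hloc _ _ _ _
    have hLS : (C • W).LSeries = W.LSeries := by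
      funext s
      simp only [WeierstrassCurve.LSeries, hL]
    have hEC : (C • W).entireContinuations = W.entireContinuations := by
      simp only [WeierstrassCurve.entireContinuations, hLS]
    have hEL : (C • W).entireLFunction = W.entireLFunction := by
      unfold WeierstrassCurve.entireLFunction
      rw [hEC, hLS]
    simp only [WeierstrassCurve.analyticRank, hEL]
  -- Selmer-rank BSD at ONE prime on a global minimal model, in three sectors
  have hmin : ∀ (V : WeierstrassCurve ℚ) [V.IsElliptic] [V.IsGloballyMinimal],
      ∃ (p : ℕ) (_ : Fact p.Prime), V.selmerCorank p = V.analyticRank := by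
    intro V _ _
    by_cases hm : ∃ (q : ℕ) (_ : Fact q.Prime), V.HasMultiplicativeReductionAtPrime q
    · -- (a) a multiplicative prime: the definite exact-order datum and the derived-height cap
      obtain ⟨p, hp, Nplus, Nminus, K, hFK, hNK, S, hFin, T, φ, hC, hθ⟩ := hDEO V hm
      obtain ⟨⟨h7, hgood, hord, hPO, hsurj, hq2, hhK⟩, hrest⟩ := hC
      have hcap : ((V.selmerCorank p : ℕ) : ℕ∞) ≤ T.acOrderOfVanishing p φ
          (Literature.NumberTheory.EllipticCurves.padicUnitRoot p (V.LFunction p)) :=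
        hCAP V p Nplus Nminus K S T φ ⟨⟨h7, hgood, hord, hPO, hsurj, hq2, hhK⟩, hrest⟩
      have hUB : V.selmerCorank p ≤ V.analyticRank := by
        have h := hcap.trans hθ
        exact_mod_cast h
      have h5 : 5 ≤ p := le_trans (by norm_num) h7
      exact ⟨p, hp, le_antisymm hUB (hLB V p h5 hgood hord hsurj)⟩
    · by_cases hW : V.HasCM
      · -- (c) CM (integral j automatically): any good ordinary p ≥ 5, then SelmerRankCM
        obtain ⟨p, hp, h5, hgood, hord⟩ := WeierstrassCurve.exists_good_ordinary_prime_holds V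
        exact ⟨p, hp, hCM V p h5 hgood hord hW⟩
      · -- (b) potentially good everywhere, no CM: the Serre big-image good ordinary prime
        obtain ⟨p, hp, h5, hgood, hord, hsurj⟩ := hSerre V hW
        exact ⟨p, hp, le_antisymm (hPG V hm p h5 hgood hord hsurj) (hLB V p h5 hgood hord hsurj)⟩
  -- transport to an arbitrary model and assemble
  refine Literature.BSD.selmerCorank_identity_imp_thesis_imp_bsd hId ?_
  intro W _
  obtain ⟨C, hC⟩ := WeierstrassCurve.hasGlobalMinimalModel_rat_holds W
  obtain ⟨p, hp, hminp⟩ := hmin (C • W)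
  refine ⟨p, hp.out, ?_, hZ W p (hSha W p)⟩
  have h1 : W.selmerCorank p = W.mordellWeilRank + W.shaCorank p := hId W p
  have h2 : (C • W).selmerCorank p = (C • W).mordellWeilRank + (C • W).shaCorank p := hId (C • W) p
  have h3 : W.shaCorank p = 0 := hZ W p (hSha W p)
  have h4 : (C • W).shaCorank p = 0 := hZ (C • W) p (hSha (C • W) p)
  have h6 := hMW W C
  have h7 := hAn W C
  omega

end Summit.BirchSwinnertonDyer.BirchSwinnertonDyer.Theses.DefiniteTheta
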